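import Summits.AtomisticToContinuum.Crystallization.Theorems.PhononSlackCertificatesWindowOptimalityCut

/-!
# Route `PhononSlackCertificates`, item `WindowOptimality` (stmt-AtomisticToContinuum-13962), part III: the matching

The window hypothesis of `WindowOptimality` says that a translate `y = x^N + t` of a ground state is
two-way `ε`-matched with the periodic configuration `P` on the ball `B(0, R)`.  For `ε` below half
the separation of `y` (`δ`, uniform for Lennard-Jones ground states) and of `P` (`s_P`), the
matching `π : site ↦ particle` (any choice of a particle within `ε` of each site of norm `≤ R`) is
injective, unique and onto the particles of norm `≤ R − ε`.  Consequences, for a site `p` with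
`‖p‖ + L ≤ R − ε` and the finite set `F` of sites within `L` of `p`:

* `le_dist_of_not_mem_image`: a particle other than `π p` that is not matched to a site of `F` is at
  distance `≥ L/2` from the particle `π p`;
* `near_sub_le_siteEnergy` (S1): `𝓔^{π p}(y) ≥ Σ_{q ∈ F} V_LJ(|p − q|) − ω·#F − τ(L)` whenever `ε`
  is small enough for the modulus `ω` of `V_LJ` at the finitely many distances `|p − q|`, where
  `τ(L) = (1/6)·1024/(δ³(L/2)³)` is the `r⁻⁶` tail of part I;
* `cross_ge` (S2): for a set `W ∋ π p` of particles, `Σ_{j ∉ W} V_LJ(|y_{π p} − y_j|) ≥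
  −#{q ∈ F : π q ∉ W}/12 − τ(L)`;
* `block_lower_bound`: summing (S1) + (S2) over the particles matched to a block of `P`
  (`Blocks.bpt`, part `ChargedEnergyGap/Negative`), deep block points have all their near sites in
  the block, so the energy carried by the matched set `W` is at least
  `k³·2#F·e(P) − k³ farSum/12 − (ω n + 2τ)·#W − (n/12)·#F·6·depth·k²`.

All `[folklore]`; helper file (`--supports`), nothing here closes the item.
-/

noncomputable section

namespace Summit.AtomisticToContinuum.Crystallization.Theorems.PhononSlackWindowOptimality

open Literature.MathematicalPhysics.StatisticalMechanics
open Summit.AtomisticToContinuum.Crystallization.Theorems.ChargedEnergyGapNegative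
open scoped BigOperators Topology
open Filter

/-- `‖a‖ ≤ ‖b‖ + dist b a`. [folklore] -/
theorem norm_le_norm_add_dist (a b : E3) : ‖a‖ ≤ ‖b‖ + dist b a := by
  have h := norm_sub_norm_le a b
  rw [← dist_eq_norm, dist_comm] at h
  linarith

section Matching

variable {P : PeriodicConfiguration 3} {N : ℕ} {y : Fin N → E3} {δ sP ε R : ℝ} {π : E3 → Fin N}

/-- **Uniqueness of the matched particle**: a particle within `ε` of a site `s` (`‖s‖ ≤ R`) is
`π s`, since two such particles would be `2ε < δ` apart. [folklore] -/
theorem eq_pi_of_dist_le (hsep : ∀ i j, i ≠ j → δ ≤ dist (y i) (y j)) (hεδ : 2 * ε < δ)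
    (hπ : ∀ s ∈ P.points, ‖s‖ ≤ R → dist (y (π s)) s ≤ ε)
    {s : E3} (hs : s ∈ P.points) (hsR : ‖s‖ ≤ R) {j : Fin N} (hj : dist (y j) s ≤ ε) :
    j = π s := by
  by_contra hne
  have h := hsep j (π s) hne
  have h' : dist (y j) (y (π s)) ≤ dist (y j) s + dist (y (π s)) s := dist_triangle_right _ _ _
  linarith [hπ s hs hsR]

/-- **Injectivity of the matching on sites**: two sites of norm `≤ R` with the same matched particle
coincide, since they would be `2ε < s_P` apart. [folklore] -/
theorem pi_inj (hsP : ∀ p ∈ P.points, ∀ q ∈ P.points, p ≠ q → sP ≤ dist p q) (hεP : 2 * ε < sP)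
    (hπ : ∀ s ∈ P.points, ‖s‖ ≤ R → dist (y (π s)) s ≤ ε)
    {s s' : E3} (hs : s ∈ P.points) (hs' : s' ∈ P.points) (hsR : ‖s‖ ≤ R) (hs'R : ‖s'‖ ≤ R)
    (h : π s = π s') : s = s' := by
  by_contra hne
  have h1 := hsP s hs s' hs' hne
  have a := hπ s hs hsR
  have b := hπ s' hs' hs'R
  rw [h] at a
  have h2 : dist s s' ≤ dist (y (π s')) s + dist (y (π s')) s' := dist_triangle_left _ _ _
  linarith

/-- **The matching is onto the deep particles**: a particle of norm `≤ R − ε` is `π s` for a site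
`s` of norm `≤ R` within `ε` of it. [folklore] -/
theorem exists_pi_eq (hsep : ∀ i j, i ≠ j → δ ≤ dist (y i) (y j)) (hεδ : 2 * ε < δ)
    (hπ : ∀ s ∈ P.points, ‖s‖ ≤ R → dist (y (π s)) s ≤ ε)
    (hfit : ∀ i, ‖y i‖ ≤ R → ∃ s ∈ P.points, dist (y i) s ≤ ε) (hε : 0 ≤ ε)
    {i : Fin N} (hi : ‖y i‖ ≤ R - ε) :
    ∃ s ∈ P.points, ‖s‖ ≤ R ∧ π s = i ∧ dist (y i) s ≤ ε := by
  obtain ⟨s, hs, hd⟩ := hfit i (by linarith)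
  have hsR : ‖s‖ ≤ R := by
    have := norm_le_norm_add_dist s (y i)
    linarith
  exact ⟨s, hs, hsR, (eq_pi_of_dist_le hsep hεδ hπ hs hsR hd).symm, hd⟩

/-- Matched particles reproduce the distances of their sites up to `2ε`. [folklore] -/
theorem abs_dist_pi_sub_le (hπ : ∀ s ∈ P.points, ‖s‖ ≤ R → dist (y (π s)) s ≤ ε)
    {s s' : E3} (hs : s ∈ P.points) (hsR : ‖s‖ ≤ R) (hs' : s' ∈ P.points) (hs'R : ‖s'‖ ≤ R) :
    |dist (y (π s)) (y (π s')) - dist s s'| ≤ 2 * ε := by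
  have a := hπ s hs hsR
  have b := hπ s' hs' hs'R
  rw [abs_le]
  constructor
  · have := dist_triangle4 s (y (π s)) (y (π s')) s'
    rw [dist_comm s (y (π s))] at this
    linarith
  · have := dist_triangle4 (y (π s)) s s' (y (π s'))
    rw [dist_comm s' (y (π s'))] at this
    linarith

/-- Sites within `L` of a site `p` with `‖p‖ + L ≤ R − ε` have norm `≤ R`. [folklore] -/
theorem norm_le_of_near {L : ℝ} {p : E3} (hpR : ‖p‖ + L ≤ R - ε) (hε : 0 ≤ ε)
    {F : Finset {q : E3 // q ∈ P.points ∧ q ≠ p}} (hF : ∀ q, q ∈ F ↔ dist p q.1 < L)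
    {q : {q : E3 // q ∈ P.points ∧ q ≠ p}} (hq : q ∈ F) : ‖q.1‖ ≤ R := by
  have h1 := (hF q).1 hq
  have h2 := norm_le_norm_add_dist q.1 p
  linarith

/-- **Unmatched particles are far.** With `p` a site, `‖p‖ + L ≤ R − ε`, `4ε ≤ L`, and `F` the sites
within `L` of `p`: a particle `j ≠ π p` which is not `π q` for any `q ∈ F` is at distance `≥ L/2`
from the particle `π p` (otherwise it is deep, hence matched to a site, which lies within `L` of
`p`). [folklore] -/
theorem le_dist_of_not_mem_image
    (hsep : ∀ i j, i ≠ j → δ ≤ dist (y i) (y j)) (hεδ : 2 * ε < δ) (hε : 0 ≤ ε)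
    (hπ : ∀ s ∈ P.points, ‖s‖ ≤ R → dist (y (π s)) s ≤ ε)
    (hfit : ∀ i, ‖y i‖ ≤ R → ∃ s ∈ P.points, dist (y i) s ≤ ε)
    {L : ℝ} (hεL : 4 * ε ≤ L) {p : E3} (hp : p ∈ P.points) (hpR : ‖p‖ + L ≤ R - ε)
    (F : Finset {q : E3 // q ∈ P.points ∧ q ≠ p}) (hF : ∀ q, q ∈ F ↔ dist p q.1 < L)
    {j : Fin N} (hji : j ≠ π p) (hjA : j ∉ F.image fun q => π q.1) :
    L / 2 ≤ dist (y (π p)) (y j) := by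
  have hL : 0 ≤ L := by linarith
  have hpR' : ‖p‖ ≤ R := by linarith
  by_contra hlt
  rw [not_le] at hlt
  have hyp : dist (y (π p)) p ≤ ε := hπ p hp hpR'
  have hyi : ‖y (π p)‖ ≤ ‖p‖ + ε := by
    have := norm_le_norm_add_dist (y (π p)) p
    rw [dist_comm] at this
    linarith
  have hyj : ‖y j‖ ≤ R - ε := by
    have := norm_le_norm_add_dist (y j) (y (π p))
    linarith
  obtain ⟨s, hs, -, hπs, hds⟩ := exists_pi_eq hsep hεδ hπ hfit hε hyj
  have hsp : s ≠ p := fun h => hji (by rw [← hπs, h])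
  have hdist : dist p s < L :=
    calc dist p s ≤ dist p (y (π p)) + dist (y (π p)) (y j) + dist (y j) s := dist_triangle4 _ _ _ _
      _ < ε + L / 2 + ε := by rw [dist_comm p]; linarith
      _ ≤ L := by linarith
  have hmem : (⟨s, hs, hsp⟩ : {q : E3 // q ∈ P.points ∧ q ≠ p}) ∈ F := (hF _).2 hdist
  exact hjA (Finset.mem_image.2 ⟨_, hmem, hπs⟩)

/-- **(S1) Site energies of matched particles are nearly lattice sums.** For a site `p` with
`‖p‖ + L ≤ R − ε`, `F` the sites within `L` of `p`, and `ω` a modulus of `V_LJ` valid at the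
distances `|p − q|`, `q ∈ F`, for perturbations `≤ 2ε`:
`Σ_{q ∈ F} V_LJ(|p − q|) − ω·#F − (1/6)·1024/(δ³(L/2)³) ≤ 𝓔^{π p}(y)`. [folklore] -/
theorem near_sub_le_siteEnergy (hδ : 0 < δ)
    (hsep : ∀ i j, i ≠ j → δ ≤ dist (y i) (y j))
    (hsP : ∀ p ∈ P.points, ∀ q ∈ P.points, p ≠ q → sP ≤ dist p q)
    (hεδ : 2 * ε < δ) (hεP : 2 * ε < sP) (hε : 0 ≤ ε)
    (hπ : ∀ s ∈ P.points, ‖s‖ ≤ R → dist (y (π s)) s ≤ ε)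
    (hfit : ∀ i, ‖y i‖ ≤ R → ∃ s ∈ P.points, dist (y i) s ≤ ε)
    {L : ℝ} (hδL : δ ≤ L / 2) (hεL : 4 * ε ≤ L)
    {p : E3} (hp : p ∈ P.points) (hpR : ‖p‖ + L ≤ R - ε)
    (F : Finset {q : E3 // q ∈ P.points ∧ q ≠ p}) (hF : ∀ q, q ∈ F ↔ dist p q.1 < L)
    {ω : ℝ} (hω : ∀ q ∈ F, ∀ r : ℝ, |r - dist p q.1| ≤ 2 * ε →
      lennardJones (dist p q.1) - ω ≤ lennardJones r) :
    ∑ q ∈ F, lennardJones (dist p q.1) - ω * F.card - 1 / 6 * (1024 / (δ ^ 3 * (L / 2) ^ 3)) ≤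
      siteEnergy lennardJones y (π p) := by
  classical
  have hL : 0 ≤ L := by linarith
  have hpR' : ‖p‖ ≤ R := by linarith
  have hqR : ∀ q ∈ F, ‖q.1‖ ≤ R := fun q hq => norm_le_of_near hpR hε hF hq
  have hinjF : ∀ q ∈ F, ∀ q' ∈ F, π q.1 = π q'.1 → q = q' := fun q hq q' hq' h =>
    Subtype.ext (pi_inj hsP hεP hπ q.2.1 q'.2.1 (hqR q hq) (hqR q' hq') h)
  have hAsub : (F.image fun q => π q.1) ⊆ Finset.univ.erase (π p) := by
    intro j hj
    obtain ⟨q, hq, rfl⟩ := Finset.mem_image.1 hj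
    refine Finset.mem_erase.2 ⟨fun h => q.2.2 ?_, Finset.mem_univ _⟩
    exact pi_inj hsP hεP hπ q.2.1 hp (hqR q hq) hpR' h
  unfold siteEnergy
  rw [← Finset.sum_sdiff hAsub, Finset.sum_image hinjF]
  have hA_ge : ∑ q ∈ F, (lennardJones (dist p q.1) - ω) ≤
      ∑ q ∈ F, lennardJones (dist (y (π p)) (y (π q.1))) :=
    Finset.sum_le_sum fun q hq => hω q hq _ (abs_dist_pi_sub_le hπ hp hpR' q.2.1 (hqR q hq))
  have hfar : ∀ j ∈ Finset.univ.erase (π p) \ F.image (fun q => π q.1),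
      L / 2 ≤ dist (y (π p)) (y j) := by
    intro j hj
    rw [Finset.mem_sdiff, Finset.mem_erase] at hj
    exact le_dist_of_not_mem_image hsep hεδ hε hπ hfit hεL hp hpR F hF hj.1.1 hj.2
  have htail := neg_le_sum_lennardJones_of_far hδ hδL hsep (π p) _ hfar
  have hcard : ∑ q ∈ F, (lennardJones (dist p q.1) - ω) =
      ∑ q ∈ F, lennardJones (dist p q.1) - ω * F.card := by
    rw [Finset.sum_sub_distrib, Finset.sum_const, nsmul_eq_mul]
    ring
  linarith

/-- **(S2) Cross terms of a matched particle.** For a set `W` of particles containing `π p`: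
`−#{q ∈ F : π q ∉ W}/12 − (1/6)·1024/(δ³(L/2)³) ≤ Σ_{j ∉ W} V_LJ(|y_{π p} − y_j|)` (near unmatched
terms are each `≥ −1/12`, the others are far). [folklore] -/
theorem cross_ge (hδ : 0 < δ)
    (hsep : ∀ i j, i ≠ j → δ ≤ dist (y i) (y j))
    (hsP : ∀ p ∈ P.points, ∀ q ∈ P.points, p ≠ q → sP ≤ dist p q)
    (hεδ : 2 * ε < δ) (hεP : 2 * ε < sP) (hε : 0 ≤ ε)
    (hπ : ∀ s ∈ P.points, ‖s‖ ≤ R → dist (y (π s)) s ≤ ε)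
    (hfit : ∀ i, ‖y i‖ ≤ R → ∃ s ∈ P.points, dist (y i) s ≤ ε)
    {L : ℝ} (hδL : δ ≤ L / 2) (hεL : 4 * ε ≤ L)
    {p : E3} (hp : p ∈ P.points) (hpR : ‖p‖ + L ≤ R - ε)
    (F : Finset {q : E3 // q ∈ P.points ∧ q ≠ p}) (hF : ∀ q, q ∈ F ↔ dist p q.1 < L)
    (W : Finset (Fin N)) (hW : π p ∈ W) :
    -(((F.filter fun q => π q.1 ∉ W).card : ℝ) / 12) - 1 / 6 * (1024 / (δ ^ 3 * (L / 2) ^ 3)) ≤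
      ∑ j ∈ Wᶜ, lennardJones (dist (y (π p)) (y j)) := by
  classical
  have hqR : ∀ q ∈ F, ‖q.1‖ ≤ R := fun q hq => norm_le_of_near hpR hε hF hq
  have hinjF : ∀ q ∈ F, ∀ q' ∈ F, π q.1 = π q'.1 → q = q' := fun q hq q' hq' h =>
    Subtype.ext (pi_inj hsP hεP hπ q.2.1 q'.2.1 (hqR q hq) (hqR q' hq') h)
  set A := F.image fun q => π q.1 with hA
  rw [← Finset.sum_filter_add_sum_filter_not Wᶜ (fun j => j ∈ A)]
  -- the near unmatched part
  have hsub : Wᶜ.filter (fun j => j ∈ A) ⊆ (F.filter fun q => π q.1 ∉ W).image fun q => π q.1 := by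
    intro j hj
    rw [Finset.mem_filter, Finset.mem_compl] at hj
    obtain ⟨q, hq, rfl⟩ := Finset.mem_image.1 hj.2
    exact Finset.mem_image.2 ⟨q, Finset.mem_filter.2 ⟨hq, hj.1⟩, rfl⟩
  have hcard : ((Wᶜ.filter fun j => j ∈ A).card : ℝ) ≤ (F.filter fun q => π q.1 ∉ W).card := by
    exact_mod_cast (Finset.card_le_card hsub).trans Finset.card_image_le
  have h1 := neg_card_le_sum_lennardJones y (π p) (Wᶜ.filter fun j => j ∈ A)
  -- the far part
  have hfar : ∀ j ∈ Wᶜ.filter (fun j => j ∉ A), L / 2 ≤ dist (y (π p)) (y j) := by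
    intro j hj
    rw [Finset.mem_filter, Finset.mem_compl] at hj
    have hji : j ≠ π p := fun h => hj.1 (h ▸ hW)
    exact le_dist_of_not_mem_image hsep hεδ hε hπ hfit hεL hp hpR F hF hji hj.2
  have h2 := neg_le_sum_lennardJones_of_far hδ hδL hsep (π p) _ hfar
  linarith

end Matching

/-! ### Summing over a block -/

section Block

variable {P : PeriodicConfiguration 3} {N : ℕ} {y : Fin N → E3} {δ sP ε R : ℝ} {π : E3 → Fin N}

/-- For a deep block point (`(depth L)`-deep lattice coordinates) every site within `L` is a block
point, hence is matched into the matched block `W`. [folklore] -/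
theorem pi_mem_of_deep (k : ℕ) {L : ℝ} {u : Blocks.BIdx P k}
    (hdeep : Blocks.IsDeep k (Blocks.depth P L) u.2)
    {F : Finset {q : E3 // q ∈ P.points ∧ q ≠ Blocks.bpt P k u}}
    (hF : ∀ q, q ∈ F ↔ dist (Blocks.bpt P k u) q.1 < L)
    {q : {q : E3 // q ∈ P.points ∧ q ≠ Blocks.bpt P k u}} (hq : q ∈ F) :
    π q.1 ∈ Finset.univ.image fun v : Blocks.BIdx P k => π (Blocks.bpt P k v) := by
  have hne : (⟨q.1, q.2.1⟩ : P.points) ≠ Blocks.toP P k u := fun h =>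
    q.2.2 (congrArg Subtype.val h)
  obtain ⟨v, -, hv⟩ := Blocks.exists_eq_toP_of_dist_lt P k hdeep ⟨q.1, q.2.1⟩ hne ((hF q).1 hq)
  have hq1 : q.1 = Blocks.bpt P k v := (congrArg Subtype.val hv).symm
  exact Finset.mem_image.2 ⟨v, Finset.mem_univ _, by rw [hq1]⟩

/-- Counting block indices with non-deep coordinates: `Σ_u [¬deep u] ≤ #F · 6·d·k²`. [folklore] -/
theorem sum_not_deep_le (k d : ℕ) :
    ∑ u : Blocks.BIdx P k, (if ¬ Blocks.IsDeep k d u.2 then (1 : ℝ) else 0) ≤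
      P.motif.card * (6 * d * (k : ℝ) ^ 2) := by
  classical
  have hin : ∀ x : {x // x ∈ P.motif},
      ∑ κ : Fin 3 → Fin k, (if ¬ Blocks.IsDeep k d (x, κ).2 then (1 : ℝ) else 0) ≤
        6 * d * (k : ℝ) ^ 2 := by
    intro x
    rw [Finset.sum_boole]
    exact_mod_cast Blocks.card_not_deep_le k d
  rw [Fintype.sum_prod_type]
  refine (Finset.sum_le_sum fun x _ => hin x).trans ?_
  rw [Finset.sum_const, Finset.card_univ, Fintype.card_coe, nsmul_eq_mul]

/-- **Lower bound for the energy carried by a matched block.** With the matching hypotheses of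
this file, `L ≥ 1`, `δ ≤ L/2`, `4ε ≤ L`, all block points `L`-inside the matched ball
(`‖bpt u‖ + L ≤ R − ε`), near finsets `F u` of radius `L` with at most `n` elements, and a
modulus `ω` valid at all near distances, the set `W = {π(bpt u)}` of matched particles carries
energy at least
`k³·(2#F·e(P)) − (1/12)k³·farSum P L − (ω n + 2τ(L))·#W − (n/12)·#F·6·depth(L)·k²`. [folklore] -/
theorem block_lower_bound (hδ : 0 < δ)
    (hsep : ∀ i j, i ≠ j → δ ≤ dist (y i) (y j))
    (hsP : ∀ p ∈ P.points, ∀ q ∈ P.points, p ≠ q → sP ≤ dist p q)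
    (hεδ : 2 * ε < δ) (hεP : 2 * ε < sP) (hε : 0 ≤ ε)
    (hπ : ∀ s ∈ P.points, ‖s‖ ≤ R → dist (y (π s)) s ≤ ε)
    (hfit : ∀ i, ‖y i‖ ≤ R → ∃ s ∈ P.points, dist (y i) s ≤ ε)
    {L : ℝ} (hL1 : 1 ≤ L) (hδL : δ ≤ L / 2) (hεL : 4 * ε ≤ L)
    (k : ℕ) (hR : ∀ u : Blocks.BIdx P k, ‖Blocks.bpt P k u‖ + L ≤ R - ε)
    (F : ∀ u : Blocks.BIdx P k, Finset {q : E3 // q ∈ P.points ∧ q ≠ Blocks.bpt P k u})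
    (hF : ∀ u q, q ∈ F u ↔ dist (Blocks.bpt P k u) q.1 < L)
    {n : ℕ} (hn : ∀ u, (F u).card ≤ n)
    {ω : ℝ} (hω0 : 0 ≤ ω) (hω : ∀ u, ∀ q ∈ F u, ∀ r : ℝ, |r - dist (Blocks.bpt P k u) q.1| ≤ 2 * ε →
      lennardJones (dist (Blocks.bpt P k u) q.1) - ω ≤ lennardJones r)
    (W : Finset (Fin N)) (hW : W = Finset.univ.image fun u : Blocks.BIdx P k => π (Blocks.bpt P k u)) :
    (k : ℝ) ^ 3 * (2 * P.motif.card * P.energyPerParticle lennardJones)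
      - 1 / 12 * ((k : ℝ) ^ 3 * Blocks.farSum P L)
      - (ω * n + 2 * (1 / 6 * (1024 / (δ ^ 3 * (L / 2) ^ 3)))) * Fintype.card (Blocks.BIdx P k)
      - (n : ℝ) / 12 * (P.motif.card * (6 * Blocks.depth P L * (k : ℝ) ^ 2)) ≤
      ∑ i ∈ W, siteEnergy lennardJones y i + ∑ i ∈ W, ∑ j ∈ Wᶜ, lennardJones (dist (y i) (y j)) := by
  classical
  have hL : 0 ≤ L := by linarith
  have hbR : ∀ u : Blocks.BIdx P k, ‖Blocks.bpt P k u‖ ≤ R := fun u => by linarith [hR u]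
  -- the matched block is an injective image
  have hinj : ∀ u ∈ (Finset.univ : Finset (Blocks.BIdx P k)), ∀ v ∈ (Finset.univ : Finset _),
      π (Blocks.bpt P k u) = π (Blocks.bpt P k v) → u = v := fun u _ v _ h =>
    Blocks.bpt_injective P k (pi_inj hsP hεP hπ (Blocks.bpt_mem P k u) (Blocks.bpt_mem P k v)
      (hbR u) (hbR v) h)
  have hmemW : ∀ u, π (Blocks.bpt P k u) ∈ W := fun u => by
    rw [hW]; exact Finset.mem_image.2 ⟨u, Finset.mem_univ _, rfl⟩
  rw [hW, Finset.sum_image hinj, Finset.sum_image hinj, ← hW]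
  -- pointwise bounds (S1), (S2)
  have hS1 : ∀ u : Blocks.BIdx P k,
      ∑ q ∈ F u, lennardJones (dist (Blocks.bpt P k u) q.1) - ω * n -
          1 / 6 * (1024 / (δ ^ 3 * (L / 2) ^ 3)) ≤
        siteEnergy lennardJones y (π (Blocks.bpt P k u)) := by
    intro u
    have h := near_sub_le_siteEnergy hδ hsep hsP hεδ hεP hε hπ hfit hδL hεL (Blocks.bpt_mem P k u)
      (hR u) (F u) (hF u) (hω u)
    have hc : ω * ((F u).card : ℝ) ≤ ω * n :=
      mul_le_mul_of_nonneg_left (by exact_mod_cast hn u) hω0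
    linarith
  have hS2 : ∀ u : Blocks.BIdx P k,
      -((if ¬ Blocks.IsDeep k (Blocks.depth P L) u.2 then (1 : ℝ) else 0) * (n / 12)) -
          1 / 6 * (1024 / (δ ^ 3 * (L / 2) ^ 3)) ≤
        ∑ j ∈ Wᶜ, lennardJones (dist (y (π (Blocks.bpt P k u))) (y j)) := by
    intro u
    have h := cross_ge hδ hsep hsP hεδ hεP hε hπ hfit hδL hεL (Blocks.bpt_mem P k u) (hR u) (F u)
      (hF u) W (hmemW u)
    have hc : (((F u).filter fun q => π q.1 ∉ W).card : ℝ) / 12 ≤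
        (if ¬ Blocks.IsDeep k (Blocks.depth P L) u.2 then (1 : ℝ) else 0) * (n / 12) := by
      by_cases hd : Blocks.IsDeep k (Blocks.depth P L) u.2
      · rw [if_neg (not_not_intro hd), zero_mul]
        have h0 : ((F u).filter fun q => π q.1 ∉ W) = ∅ := by
          refine Finset.filter_false_of_mem fun q hq => ?_
          rw [not_not, hW]
          exact pi_mem_of_deep k hd (hF u) hq
        rw [h0, Finset.card_empty, Nat.cast_zero, zero_div]
      · rw [if_pos hd, one_mul]
        have : (((F u).filter fun q => π q.1 ∉ W).card : ℝ) ≤ n := by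
          exact_mod_cast (Finset.card_filter_le _ _).trans (hn u)
        linarith
    exact (sub_le_sub_right (neg_le_neg hc) _).trans h
  have hsum1 := Finset.sum_le_sum fun u (_ : u ∈ Finset.univ) => hS1 u
  have hsum2 := Finset.sum_le_sum fun u (_ : u ∈ Finset.univ) => hS2 u
  have hnear := sum_near_ge_block P k hL1 F hF
  have hdeep := sum_not_deep_le (P := P) k (Blocks.depth P L)
  rw [Finset.sum_sub_distrib, Finset.sum_sub_distrib, Finset.sum_const, Finset.sum_const,
    Finset.card_univ, nsmul_eq_mul, nsmul_eq_mul] at hsum1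
  rw [Finset.sum_sub_distrib, Finset.sum_neg_distrib, Finset.sum_const, Finset.card_univ,
    nsmul_eq_mul, ← Finset.sum_mul] at hsum2
  have hn0 : (0 : ℝ) ≤ n / 12 := by positivity
  have hdeep' := mul_le_mul_of_nonneg_right hdeep hn0
  nlinarith [hsum1, hsum2, hnear, hdeep']

end Block

end Summit.AtomisticToContinuum.Crystallization.Theorems.PhononSlackWindowOptimality

end
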